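import Summits.ValiantsHypothesis.ValiantsHypothesis.Theses.ContractivityPrice
import Summits.ValiantsHypothesis.ValiantsHypothesis.Theorems.PrincipalMinorColouringTotalRankSuperlinear

/-!
# Route ContractivityPrice — the crux `CdcSuperquadratic` (stmt-ValiantsHypothesis-10585) is PROVED
# (Hrubeš–Joglekar 2025, Thm. 7 + the block-determinant dictionary, re-centred at `I + X/(4n)`)

Crux (rank 4) of route `ContractivityPrice`: «`∃ ε > 0, ∃ n₀, ∀ n ≥ n₀`, every normalised expression
`per_n(I + X/(4n)) = a · det(1 + diag(X∘κ)·K)` with `‖K‖ ≤ 1` has `R ≥ n^(2+ε)`». The refuter's crux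
attack (2026-08-15) found it TRUE and provable now, with the norm hypothesis UNUSED: undo the affine
substitution by the algebra automorphism `X e ↦ 4n·(X e - δ_e)` to get
`per_n = C a · det((1 - 4n·diag(δ∘κ)·K) + diag(X∘κ)·(4n·K))`, read this as a symbolic determinantal
representation of `per_n` of variable size exactly `R`
(`PrincipalMinorColouring.exists_symbDetRepr_of_eq_det`), and apply Hrubeš–Joglekar's Thm. 7 in the
form `PrincipalMinorColouring.rpow_le_of_symbDetRepr` (`ε = 1/4`). Same dictionary as the sibling file
`PrincipalMinorColouringTotalRankSuperlinear.lean` (crux `TotalRankSuperlinear`). Honest framing: a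
published `n^{2+1/4}` lower bound on the NUMBER of variable occurrences, formalised; it does not use
contractivity and says nothing about the route's law `PriceOfContractivity`, nor about `VP ≠ VNP`.
References: Hrubeš–Joglekar 2025, Thm. 7 [HrubesJoglekar2025].
-/

set_option linter.dupNamespace false

namespace Summit.ValiantsHypothesis.ValiantsHypothesis.Theorems.ContractivityPrice

open MvPolynomial Matrix Literature.Computability.AlgebraicComplexity
open Summit.ValiantsHypothesis.ValiantsHypothesis.Theses.ContractivityPrice
open Summit.ValiantsHypothesis.ValiantsHypothesis.Theorems.PrincipalMinorColouring

/-- **Crux `CdcSuperquadratic` (stmt-ValiantsHypothesis-10585), PROVED** with `ε = 1/4` (the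
contractivity hypothesis `‖K‖ ≤ 1` is not used). [cite: HrubesJoglekar2025, Thm. 7] -/
theorem cdcSuperquadratic_proof : CdcSuperquadratic := by
  obtain ⟨ε, hε, n₁, hmain⟩ := rpow_le_of_symbDetRepr
  refine ⟨ε, hε, max n₁ 1, fun n hn R a K κ _ h => hmain n (le_trans (le_max_left _ _) hn) R ?_⟩
  have hn1 : 1 ≤ n := le_trans (le_max_right _ _) hn
  have h4n : (4 * (n : ℂ)) ≠ 0 := by
    have : (n : ℂ) ≠ 0 := by exact_mod_cast (show n ≠ 0 by omega)
    exact mul_ne_zero (by norm_num) this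
  -- the 0/1 diagonal data of the centre `I`
  set d : Fin R → ℂ := fun i => if (κ i).1 = (κ i).2 then 1 else 0 with hd
  -- undo the substitution `X e ↦ δ_e + X e / (4n)`
  set ψ : MvPolynomial (Fin n × Fin n) ℂ →ₐ[ℂ] MvPolynomial (Fin n × Fin n) ℂ :=
    aeval (fun e => C (4 * (n : ℂ)) * (X e - C (if e.1 = e.2 then (1 : ℂ) else 0))) with hψ
  have hcomp : ∀ p : MvPolynomial (Fin n × Fin n) ℂ,
      ψ (aeval (fun e : Fin n × Fin n => C (if e.1 = e.2 then (1 : ℂ) else 0) +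
        C ((4 * (n : ℂ))⁻¹) * X e) p) = p := by
    intro p
    have h1 : ψ.comp (aeval fun e : Fin n × Fin n =>
        (C (if e.1 = e.2 then (1 : ℂ) else 0) + C ((4 * (n : ℂ))⁻¹) * X e :
          MvPolynomial (Fin n × Fin n) ℂ)) = AlgHom.id ℂ _ := by
      rw [comp_aeval]
      have hψC : ∀ r : ℂ, ψ (C r) = C r := fun r => ψ.commutes r
      have hψX : ∀ e : Fin n × Fin n,
          ψ (X e) = C (4 * (n : ℂ)) * (X e - C (if e.1 = e.2 then (1 : ℂ) else 0)) := fun e => by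
        rw [hψ]
        exact aeval_X _ e
      have : (fun i : Fin n × Fin n => ψ (C (if i.1 = i.2 then (1 : ℂ) else 0) +
          C ((4 * (n : ℂ))⁻¹) * X i)) = X := by
        funext i
        rw [map_add ψ, map_mul ψ, hψC, hψC, hψX, ← mul_assoc, ← map_mul C, inv_mul_cancel₀ h4n,
          map_one, one_mul]
        abel
      rw [this, aeval_X_left]
    exact congrArg (fun F : MvPolynomial (Fin n × Fin n) ℂ →ₐ[ℂ] MvPolynomial (Fin n × Fin n) ℂ => F p) h1
  have hK : (K.map C : Matrix (Fin R) (Fin R) (MvPolynomial (Fin n × Fin n) ℂ)).map ψ = K.map C := by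
    rw [Matrix.map_map]
    congr 1
    funext b
    exact ψ.commutes b
  have hD : (Matrix.diagonal (fun i => (X (κ i) : MvPolynomial (Fin n × Fin n) ℂ))).map ψ =
      Matrix.diagonal (fun i => C (4 * (n : ℂ)) * (X (κ i) - C (d i))) := by
    rw [Matrix.diagonal_map (map_zero ψ)]
    congr 1
    funext i
    simp only [hψ, hd, aeval_X]
  -- the matrix identity behind the dictionary
  have hmat : ψ.mapMatrix (1 + Matrix.diagonal (fun i => (X (κ i) : MvPolynomial (Fin n × Fin n) ℂ)) *
      K.map (fun b : ℂ => (C b : MvPolynomial (Fin n × Fin n) ℂ))) =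
      (1 - (4 * (n : ℂ)) • (Matrix.diagonal d * K)).map C +
        Matrix.diagonal (fun i => X (κ i)) * ((4 * (n : ℂ)) • K).map C := by
    rw [map_add, map_one, map_mul, AlgHom.mapMatrix_apply, AlgHom.mapMatrix_apply, hK, hD]
    refine Matrix.ext fun i j => ?_
    simp only [Matrix.add_apply, Matrix.one_apply, Matrix.diagonal_mul, Matrix.map_apply,
      Matrix.sub_apply, Matrix.smul_apply, smul_eq_mul, map_sub, map_mul C]
    split_ifs <;> (try simp only [map_one, map_zero]) <;> ring
  have key := congrArg ψ h
  rw [hcomp, map_mul, AlgHom.map_det, hmat] at key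
  have hψC : ψ (C a) = C a := ψ.commutes _
  rw [hψC] at key
  exact exists_symbDetRepr_of_eq_det a _ _ κ key

end Summit.ValiantsHypothesis.ValiantsHypothesis.Theorems.ContractivityPrice
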